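import Literature.NumberTheory.Transcendental.NesterenkoUResultantDegree
import Literature.NumberTheory.Transcendental.NesterenkoEliminationCor412Proofs
import HarnessLib

/-!
# The `u`-resultant of the Chow form of a prime with a form, VII: the archimedean bound at complex points (towards LNM 1752 Ch. 3 Prop. 4.11 2)–3), route B)

`Literature/NumberTheory/Transcendental/NesterenkoUResultantArchBound.lean`. For a homogeneous
prime `𝔭` of rank `s + 1`, `F` its associated form (`D = deg 𝔭`), an integer form `Q₀` of degree
`d` and `G = uResultant 𝔭 s d Q₀`, we prove the basic archimedean inequality behind parts 2) and 3)
of Proposition 4.11: for EVERY `z ∈ ℂ^{s(m+1)}`,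

  `|G(z)| ≤ ‖Q₀‖₁^D · (e^{m D} · |F(z; ·)|)^d`          (`norm_aeval_uResultant_le`)

where `|F(z; ·)|` is the maximum modulus of the coefficients of the form `F(z; ·) ∈ ℂ[u_{s+1}]`
(`maxNormSpec`) and `‖Q₀‖₁` the sum of the moduli of the coefficients of `Q₀`. At a GENERIC `z`
this follows from the splitting `F(z; ·) = ĉ ∏ (β̂⁽ⁱ⁾ · u)`, `G(z) = ĉ^d ∏ Q₀(β̂⁽ⁱ⁾)`
(`exists_split_complexSpec`): `|Q₀(β̂)| ≤ ‖Q₀‖₁ |β̂|^d` and **Gelfond's inequality for the product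
of the `D` linear forms, dehomogenised** (`prod_norm_le_exp_mul_maxNorm_prod_lin`:
`|ĉ| ∏ |β̂⁽ⁱ⁾| ≤ e^{mD} |F(z; ·)|`, the exponent `m D` — not `(m+1) D` — being what the printed
constant `m(r+1)` of Prop. 4.11 2) requires); it extends to all `z` by density of the generic
points and continuity (`NesterenkoGenericPoints.lean`).

No named facts; one plumbing definition (`maxNormSpec z P = |P(z; ·)|`).

## References

* [NesterenkoPhilippon2001] Yu. V. Nesterenko, P. Philippon (eds.), *Introduction to Algebraic
  Independence Theory*, LNM 1752, Springer 2001, Ch. 3 §4, Prop. 4.11 (pp. 40–41).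
* [BombieriGubler2006] E. Bombieri, W. Gubler, *Heights in Diophantine Geometry*, Lemma 1.6.11
  (Gelfond's inequality).
-/

noncomputable section

open MvPolynomial
open Literature.NumberTheory.Transcendental.PhilipponMain

attribute [local instance] MvPolynomial.gradedAlgebra

namespace Literature.NumberTheory.Transcendental

namespace Nesterenko

variable {m : ℕ}

/-! ### Linear forms and integer forms at complex points -/

/-- `|β · u| = |β|` (maximum modulus of the coefficients of a linear form). [folklore] -/
theorem maxNorm_linC (β : Fin (m + 1) → ℂ) :
    maxNorm ((∑ j, C (β j) * X j) : MvPolynomial (Fin (m + 1)) ℂ) = ‖β‖ := by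
  classical
  apply le_antisymm
  · refine maxNorm_le_of_forall_le (norm_nonneg _) fun γ _ => ?_
    have hlin : ((∑ j, C (β j) * X j) : MvPolynomial (Fin (m + 1)) ℂ) =
        ∑ j, monomial (Finsupp.single j 1) (β j) :=
      Finset.sum_congr rfl fun j _ => by rw [C_mul_X_eq_monomial]
    rw [hlin, coeff_sum]
    simp only [coeff_monomial]
    by_cases h : ∃ j, Finsupp.single j 1 = γ
    · obtain ⟨j, rfl⟩ := h
      rw [Finset.sum_eq_single j (fun k _ hk => by
          rw [if_neg (fun h' => hk (Finsupp.single_left_injective one_ne_zero h'))])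
        (fun h' => absurd (Finset.mem_univ j) h'), if_pos rfl]
      exact norm_le_pi_norm β j
    · push Not at h
      rw [Finset.sum_eq_zero (fun k _ => by rw [if_neg (h k)]), norm_zero]
      exact norm_nonneg _
  · obtain ⟨j, hj⟩ := exists_norm_apply_eq_norm β
    rw [← hj, ← coeff_single_linK β j]
    exact norm_coeff_le_maxNorm _ _

/-- `|∏ βⱼ^{eⱼ}| ≤ |β|^{|e|}`. [folklore] -/
theorem norm_prod_pow_le (β : Fin (m + 1) → ℂ) (e : Fin (m + 1) →₀ ℕ) :
    ‖∏ j, β j ^ e j‖ ≤ ‖β‖ ^ e.degree := by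
  rw [norm_prod, Finsupp.degree_eq_sum, ← Finset.prod_pow_eq_pow_sum]
  refine Finset.prod_le_prod (fun j _ => norm_nonneg _) fun j _ => ?_
  rw [norm_pow]
  exact pow_le_pow_left₀ (norm_nonneg _) (norm_le_pi_norm β j) _

/-- **`|Q₀(β)| ≤ ‖Q₀‖₁ |β|^d`** for an integer form `Q₀` of degree `d` (`‖·‖₁` the sum of the
moduli of the coefficients, `|β|` the sup norm). [folklore] -/
theorem norm_aeval_le_l1Norm_mul_pow {Q₀ : MvPolynomial (Fin (m + 1)) ℤ} {d : ℕ}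
    (hQ : Q₀.IsHomogeneous d) (β : Fin (m + 1) → ℂ) :
    ‖aeval β Q₀‖ ≤ l1Norm (map (Int.castRingHom ℂ) Q₀) * ‖β‖ ^ d := by
  classical
  have hP : (map (Int.castRingHom ℂ) Q₀).IsHomogeneous d := hQ.map _
  have e1 : aeval β Q₀ = eval β (map (Int.castRingHom ℂ) Q₀) := by
    rw [eval_map, aeval_def]; rfl
  rw [e1, eval_eq', l1Norm, Finset.sum_mul]
  refine (norm_sum_le _ _).trans (Finset.sum_le_sum fun e he => ?_)
  rw [norm_mul]
  refine mul_le_mul_of_nonneg_left ?_ (norm_nonneg _)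
  have hdeg : e.degree = d := by
    have h := hP (mem_support_iff.mp he)
    rw [Finsupp.degree, ← h, Finsupp.weight_apply]
    simp [Finsupp.sum]
  rw [← hdeg]
  exact norm_prod_pow_le β e

/-! ### Gelfond's inequality for a product of linear forms, dehomogenised -/

/-- **Gelfond's inequality for linear forms (dehomogenised).** For non-zero
`β⁽⁰⁾, …, β⁽ᴰ⁻¹⁾ ∈ ℂ^{m+1}`: `∏ᵢ |β⁽ⁱ⁾| ≤ e^{m D} · |∏ᵢ (β⁽ⁱ⁾ · u)|` (maximum moduli of
coefficients; the linear forms are first dehomogenised — one variable set to `1` — which keeps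
their coefficients and leaves `m` variables of degree `1` each, whence Gelfond's constant
`e^{m D}`). [cite: BombieriGubler2006, §1.6, Lemma 1.6.11 (p. 27)] -/
theorem prod_norm_le_exp_mul_maxNorm_prod_lin {D : ℕ} (β : Fin D → Fin (m + 1) → ℂ)
    (hβ : ∀ i, β i ≠ 0) :
    ∏ i, ‖β i‖ ≤ Real.exp ((m : ℝ) * D) *
      maxNorm (∏ i, (∑ j, C (β i j) * X j) : MvPolynomial (Fin (m + 1)) ℂ) := by
  classical
  set ι₀ : Fin (m + 1) → Fin 1 × Fin (m + 1) := fun j => (0, j) with hι₀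
  have hι₀inj : Function.Injective ι₀ := prodMk_zero_injective
  -- the linear forms in block indexing (`x_j ↦ (0, j)`; block-homogeneity and injectivity are
  -- `rename_prodMk_blockHom` / `prodMk_zero_injective` of `NesterenkoEliminationCor412Proofs`),
  -- and their dehomogenisations
  set f : Fin D → MvPolynomial (Fin 1 × Fin (m + 1)) ℂ :=
    fun i => rename ι₀ (∑ j, C (β i j) * X j) with hf
  set g : Fin D → MvPolynomial (Fin 1 × {a : Fin (m + 1) // a ≠ 0}) ℂ :=
    fun i => dehom ℂ (0 : Fin (m + 1)) (f i) with hg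
  have hfhom : ∀ i, ∀ e ∈ (f i).support, ∀ i' : Fin 1, ∑ a, e (i', a) = 1 := fun i e he i' =>
    rename_prodMk_blockHom (isHomogeneous_linK (β i)) e he i'
  have hinj : ∀ i, Set.InjOn (dehomIdx (r := 1) (0 : Fin (m + 1))) (f i).support := fun i =>
    injOn_dehomIdx 0 (D := fun _ => 1) (hfhom i)
  have hf0 : ∀ i, f i ≠ 0 := fun i => by
    rw [hf]
    exact (map_ne_zero_iff _ (rename_injective _ hι₀inj)).mpr (linK_ne_zero (hβ i))
  have hg0 : ∀ i, g i ≠ 0 := fun i => dehom_ne_zero 0 (hinj i) (hf0 i)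
  have hgmax : ∀ i, maxNorm (g i) = ‖β i‖ := fun i => by
    rw [hg, maxNorm_dehom 0 (f i) (hinj i), hf, maxNorm_rename_of_injective hι₀inj, maxNorm_linC]
  have hgdeg : ∀ i v, degreeOf v (g i) ≤ 1 := fun i v =>
    degreeOf_dehom_le 0 (f i) (D := fun _ => 1) (hfhom i) v.1 v.2
  -- the product
  set P : MvPolynomial (Fin (m + 1)) ℂ := ∏ i, (∑ j, C (β i j) * X j) with hP
  have hPhom : P.IsHomogeneous D := by
    have := IsHomogeneous.prod Finset.univ (fun i => (∑ j, C (β i j) * X j :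
      MvPolynomial (Fin (m + 1)) ℂ)) (fun _ => 1) fun i _ => isHomogeneous_linK (β i)
    simpa using this
  have hprodg : ∏ i, g i = dehom ℂ (0 : Fin (m + 1)) (rename ι₀ P) := by
    rw [hg, ← map_prod, hf, ← map_prod]
  have hinjP : Set.InjOn (dehomIdx (r := 1) (0 : Fin (m + 1))) (rename ι₀ P).support :=
    injOn_dehomIdx 0 (D := fun _ => D) fun e he i' => rename_prodMk_blockHom hPhom e he i'
  have hmaxP : maxNorm (∏ i, g i) = maxNorm P := by
    rw [hprodg, maxNorm_dehom 0 _ hinjP, maxNorm_rename_of_injective hι₀inj]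
  -- Gelfond
  have hgelf := sum_log_maxNorm_le Finset.univ g (fun i _ => hg0 i)
  have hvars : (∑ v : Fin 1 × {a : Fin (m + 1) // a ≠ 0}, (∑ i, degreeOf v (g i) : ℝ)) ≤
      (m : ℝ) * D := by
    calc (∑ v : Fin 1 × {a : Fin (m + 1) // a ≠ 0}, (∑ i, degreeOf v (g i) : ℝ))
        ≤ ∑ _v : Fin 1 × {a : Fin (m + 1) // a ≠ 0}, (D : ℝ) := Finset.sum_le_sum fun v _ => by
          calc (∑ i, degreeOf v (g i) : ℝ) ≤ ∑ _i : Fin D, (1 : ℝ) :=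
                Finset.sum_le_sum fun i _ => by exact_mod_cast hgdeg i v
            _ = D := by simp
      _ = (m : ℝ) * D := by
          rw [Finset.sum_const, Finset.card_univ, nsmul_eq_mul]
          simp [Fintype.card_subtype_compl]
  -- exponentiate
  have hpos : ∀ i, 0 < maxNorm (g i) := fun i => maxNorm_pos (hg0 i)
  have hPpos : 0 < maxNorm (∏ i, g i) := maxNorm_pos (Finset.prod_ne_zero_iff.mpr fun i _ => hg0 i)
  have e1 : ∏ i, ‖β i‖ = Real.exp (∑ i, Real.log (maxNorm (g i))) := by
    rw [Real.exp_sum]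
    exact Finset.prod_congr rfl fun i _ => by rw [← hgmax i, Real.exp_log (hpos i)]
  rw [e1, ← hmaxP, ← Real.exp_log hPpos, ← Real.exp_add]
  refine Real.exp_le_exp.mpr ?_
  linarith [hgelf, hvars]

/-! ### `|F(z; ·)|` and its continuity in `z` -/

/-- `|map φ P|` in terms of the coefficients of `P`. [folklore] -/
theorem maxNorm_map_eq {R σ : Type*} [CommSemiring R] (φ : R →+* ℂ) (P : MvPolynomial σ R) :
    maxNorm (MvPolynomial.map φ P) = ((P.support.sup fun e => ‖φ (coeff e P)‖₊ : NNReal) : ℝ) := by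
  classical
  unfold maxNorm
  congr 1
  apply le_antisymm
  · refine (Finset.sup_mono (support_map_subset φ P)).trans_eq' ?_
    refine Finset.sup_congr rfl fun e _ => ?_
    rw [coeff_map]
  · refine Finset.sup_le fun e _ => ?_
    by_cases he : e ∈ (MvPolynomial.map φ P).support
    · rw [← coeff_map]
      exact Finset.le_sup (f := fun γ => ‖(MvPolynomial.map φ P).coeff γ‖₊) he
    · rw [← coeff_map, notMem_support_iff.mp he, nnnorm_zero]
      exact bot_le

/-- **`z ↦ |P(z; ·)|` is continuous** (`P` a polynomial in `u_{s+1}` with coefficients in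
`ℚ[u₁, …, u_s]`, specialised at `z`). [folklore] -/
theorem continuous_maxNorm_map_aeval {ι : Type*} [Fintype ι] {σ : Type*}
    (P : MvPolynomial σ (MvPolynomial ι ℚ)) :
    Continuous fun z : ι → ℂ =>
      maxNorm (MvPolynomial.map ((aeval z : MvPolynomial ι ℚ →ₐ[ℚ] ℂ) : MvPolynomial ι ℚ →+* ℂ) P) := by
  simp_rw [maxNorm_map_eq]
  refine NNReal.continuous_coe.comp ?_
  refine Continuous.finset_sup_apply fun e _ => ?_
  exact (continuous_aeval (coeff e P)).nnnorm

/-! ### The archimedean bound on the `u`-resultant -/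

section Prime

variable {s : ℕ} {𝔭 : Ideal (Rx m)}

/-- **`|G(z)| ≤ ‖Q₀‖₁^D (e^{mD} |F(z; ·)|)^d` at a generic point `z`** (splitting of `F(z; ·)` into
linear forms, `|Q₀(β̂)| ≤ ‖Q₀‖₁|β̂|^d`, and Gelfond's inequality for the linear forms).
[cite: NesterenkoPhilippon2001, Ch. 3 Prop. 4.11 (pp. 40–41)] -/
theorem norm_aeval_uResultant_le_of_injective (h𝔭 : 𝔭.IsPrime)
    (hhom : 𝔭.IsHomogeneous (homogeneousSubmodule (Fin (m + 1)) ℚ))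
    (hdim : ringKrullDim (Rx m ⧸ 𝔭) = (s + 1 : ℕ)) {d : ℕ} {Q₀ : MvPolynomial (Fin (m + 1)) ℤ}
    (hQ : Q₀.IsHomogeneous d) {z : Fin s × Fin (m + 1) → ℂ}
    (hz : Function.Injective (aeval z : RU s m →ₐ[ℚ] ℂ)) :
    ‖aeval z (uResultant 𝔭 s d Q₀)‖ ≤
      l1Norm (map (Int.castRingHom ℂ) Q₀) ^ ideg 𝔭 (s + 1) *
        (Real.exp ((m : ℝ) * ideg 𝔭 (s + 1)) *
          maxNorm (MvPolynomial.map ((aeval z : RU s m →ₐ[ℚ] ℂ) : RU s m →+* ℂ)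
            (splitLast s m (chowForm 𝔭 (s + 1))))) ^ d := by
  obtain ⟨cz, bz, -, hbz, -, -, hF, hG⟩ := exists_split_complexSpec h𝔭 hhom hdim hQ hz
  have hL0 : 0 ≤ l1Norm (map (Int.castRingHom ℂ) Q₀) := l1Norm_nonneg _
  -- `|G(z)| ≤ L^D (|ĉ| ∏ |β̂ i|)^d`
  have h1 : ‖aeval z (uResultant 𝔭 s d Q₀)‖ ≤
      l1Norm (map (Int.castRingHom ℂ) Q₀) ^ ideg 𝔭 (s + 1) * (‖cz‖ * ∏ i, ‖bz i‖) ^ d := by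
    rw [hG, norm_mul, norm_pow, norm_prod]
    calc ‖cz‖ ^ d * ∏ i, ‖aeval (bz i) Q₀‖
        ≤ ‖cz‖ ^ d * ∏ i, (l1Norm (map (Int.castRingHom ℂ) Q₀) * ‖bz i‖ ^ d) :=
          mul_le_mul_of_nonneg_left (Finset.prod_le_prod (fun i _ => norm_nonneg _)
            fun i _ => norm_aeval_le_l1Norm_mul_pow hQ (bz i)) (by positivity)
      _ = l1Norm (map (Int.castRingHom ℂ) Q₀) ^ ideg 𝔭 (s + 1) * (‖cz‖ * ∏ i, ‖bz i‖) ^ d := by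
          rw [Finset.prod_mul_distrib, Finset.prod_const, Finset.card_univ, Fintype.card_fin,
            mul_pow, Finset.prod_pow]
          ring
  -- Gelfond: `|ĉ| ∏ |β̂ i| ≤ e^{mD} |F(z; ·)|`
  have h2 : ‖cz‖ * ∏ i, ‖bz i‖ ≤ Real.exp ((m : ℝ) * ideg 𝔭 (s + 1)) *
      maxNorm (MvPolynomial.map ((aeval z : RU s m →ₐ[ℚ] ℂ) : RU s m →+* ℂ)
        (splitLast s m (chowForm 𝔭 (s + 1)))) := by
    rw [hF, maxNorm_C_mul]
    calc ‖cz‖ * ∏ i, ‖bz i‖ ≤ ‖cz‖ * (Real.exp ((m : ℝ) * ideg 𝔭 (s + 1)) *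
          maxNorm (∏ i, (∑ j, C (bz i j) * X j) : MvPolynomial (Fin (m + 1)) ℂ)) :=
          mul_le_mul_of_nonneg_left (prod_norm_le_exp_mul_maxNorm_prod_lin bz hbz) (norm_nonneg _)
      _ = _ := by ring
  calc ‖aeval z (uResultant 𝔭 s d Q₀)‖
      ≤ l1Norm (map (Int.castRingHom ℂ) Q₀) ^ ideg 𝔭 (s + 1) * (‖cz‖ * ∏ i, ‖bz i‖) ^ d := h1
    _ ≤ _ := by
        refine mul_le_mul_of_nonneg_left (pow_le_pow_left₀ (by positivity) h2 d) (by positivity)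

/-- **The archimedean bound at every complex point**: for all `z ∈ ℂ^{s(m+1)}`,
`|G(z)| ≤ ‖Q₀‖₁^D (e^{mD} |F(z; ·)|)^d` (from the generic points by density and continuity).
[cite: NesterenkoPhilippon2001, Ch. 3 Prop. 4.11 (pp. 40–41)] -/
theorem norm_aeval_uResultant_le (h𝔭 : 𝔭.IsPrime)
    (hhom : 𝔭.IsHomogeneous (homogeneousSubmodule (Fin (m + 1)) ℚ))
    (hdim : ringKrullDim (Rx m ⧸ 𝔭) = (s + 1 : ℕ)) {d : ℕ} {Q₀ : MvPolynomial (Fin (m + 1)) ℤ}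
    (hQ : Q₀.IsHomogeneous d) (z : Fin s × Fin (m + 1) → ℂ) :
    ‖aeval z (uResultant 𝔭 s d Q₀)‖ ≤
      l1Norm (map (Int.castRingHom ℂ) Q₀) ^ ideg 𝔭 (s + 1) *
        (Real.exp ((m : ℝ) * ideg 𝔭 (s + 1)) *
          maxNorm (MvPolynomial.map ((aeval z : RU s m →ₐ[ℚ] ℂ) : RU s m →+* ℂ)
            (splitLast s m (chowForm 𝔭 (s + 1))))) ^ d := by
  refine le_of_forall_generic (f := fun z : Fin s × Fin (m + 1) → ℂ =>
    ‖aeval z (uResultant 𝔭 s d Q₀)‖) ?_ ?_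
    (fun z hz => norm_aeval_uResultant_le_of_injective h𝔭 hhom hdim hQ hz) z
  · exact (continuous_aeval _).norm
  · exact continuous_const.mul ((continuous_const.mul (continuous_maxNorm_map_aeval _)).pow d)

end Prime

end Nesterenko

end Literature.NumberTheory.Transcendental

end
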